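import Summits.BirchSwinnertonDyer.BirchSwinnertonDyer.Theorems.Rank1ResidualJetRowDualityPrep
import Summits.BirchSwinnertonDyer.BirchSwinnertonDyer.Theorems.Rank1ResidualJetCoreVertexSign
import HarnessLib

/-!
# T1 JET (cell `bsd-jet`), road K: the hypothesis `hdual_q` of the row theorem (Jetchev Thm. 5.1 at
# the carrier for `𝓕_⌈q⌉(c) ≼ 𝓕(c)`, signed parts, and (δ)) DERIVED from the signed Poitou–Tate
# counting, for the dual module `C' = (w⁻¹ H¹_{𝓕_⌈q⌉(c)^*})^s ⊆ H¹(K, E[p^k])`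

HONEST FRAMING (programme file `BSD-LIT2PART-PROGRAMME-v1.md` §HONESTY, verbatim): «no tranche here
proves BSD; ARM L moves the LITERAL column of an r ≤ 1 census into the kernel-proved-modulo-named-print
column; ARM P changes what «named print» is worth.» THEOREMS ONLY (seat `bsd-jet-pv-1`, session g5;
`--supports stmt-BirchSwinnertonDyer-14418`, helper): no definition, no named fact, no `sorry`.
Nothing is booked; 0 classes move.

## What

`exists_locq_of_pair`: in the currency of `JET.tamagawaExponent_le_mInfty_of_rowData` (pv-2, p492296)
— `H = H¹(K, E[p^k])`, `signPart`, `selmerF` ∕ `selmerF0` — and for the EXPLICIT dual module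
`C' := signPart s (w⁻¹ H¹_{𝓕₀^*})` (`w` the Weil transport of a datum `e`, `𝓕₀ = selmerF0 … {v₀, τv₀}`,
`𝓕 = selmerF …`), the package

`∃ Qg Qg' (fin) (locq : (H_𝓕)^s →+ Qg) (locq' : C' →+ Qg'), (ker locq' = C' ∩ H_𝓕^s) ∧
 #im locq · #im locq' = #Qg' ∧ Qg' cyclic ∧ #Qg' = p^t`,

with `Qg = Kum_{v₀}/𝒮_{v₀}`, `Qg' = 𝒮_{v₀}^⊥/Kum_{v₀}^⊥`, `locq = loc_{v₀}`, `locq' = loc'_{v₀} ∘ w`. Inputs: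
a conjugation-compatible family `inv` with local duality + Poitou–Tate vanishing + Howard's complement
property (conjuncts of `poitouTate_selmerStructure_duality_conj`), a Weil datum equivariant under the
lift of `τ`, `τ² = 1`, `p` odd, the transverse family `𝒯` `σ`-stable and self-dual at the primes
dividing `c`, the stringent family `𝒮 ≤ Kum` `σ`-stable at the carrier pair with `Kum_{v₀}/𝒮_{v₀}`
cyclic of order `p^t`. Ingredients: `relIndex_mul_relIndex_eq_of_pair`, the eigenclass kernel lemmas,
the local count and cyclicity transfer (`…SignedDualityPair`), the Weil transport
(`…WeilTransportSelmer`), the bookkeeping of `…RowDualityPrep`.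

References (locators only; no cited FACT is declared): [cite: Jetchev2008, Thm. 5.1, Lemma 5.2, proof
of Thm. 5.2 ∕ arXiv Thm. 6.3 (pp. 821–823)] [cite: Howard2004HeegnerKolyvagin, Thm. 2.1.11]
[cite: MilneADT2006, Ch. I §0 (0.19), Cor. 2.3]. Design: no definitions; `K : Type`. Axioms:
`propext`, `Classical.choice`, `Quot.sound`.
-/

set_option autoImplicit false

noncomputable section

open scoped Classical Pointwise
open Function NumberField IsDedekindDomain WeierstrassCurve Field
open Literature.NumberTheory.EllipticCurves Literature.NumberTheory.GaloisRepresentations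
open Literature.NumberTheory.EllipticCurves.Jetchev2008
open Literature.NumberTheory.GaloisCohomology Literature.NumberTheory.Automorphic
open Literature.NumberTheory.GaloisRepresentations.DiscreteGaloisModule (localTatePairingZMod
  tateDual SelmerStructure)
open Summit.BirchSwinnertonDyer.Rank1Residual.JET.SelmerVocabulary

namespace Summit.BirchSwinnertonDyer.Rank1Residual.JET.GlobalDuality

/-! ### Two generic counting helpers -/

section Generic

variable {G Q : Type*} [AddCommGroup G] [AddCommGroup Q]

/-- `#im f = [B : A]` for `f : B → Q` whose kernel is `A ∩ B` (first isomorphism theorem). -/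
theorem natCard_range_eq_relIndex {A B : AddSubgroup G} (f : B →+ Q)
    (hf : ∀ x : B, f x = 0 ↔ (x : G) ∈ A) : Nat.card f.range = A.relIndex B := by
  have hker : f.ker = A.addSubgroupOf B := by
    ext x; rw [AddMonoidHom.mem_ker, hf, AddSubgroup.mem_addSubgroupOf]
  rw [← Nat.card_congr (QuotientAddGroup.quotientKerEquivRange f).toEquiv, hker,
    ← AddSubgroup.index_eq_card]
  rfl

/-- `#(B/A) = [B : A]` for the quotient by `A ∩ B`. -/
theorem natCard_quotient_addSubgroupOf (A B : AddSubgroup G) :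
    Nat.card (B ⧸ A.addSubgroupOf B) = A.relIndex B := by
  rw [← AddSubgroup.index_eq_card]; rfl

end Generic

/-! ### `signPart` is the intersection with an eigen-kernel -/

section SignPart

variable {K : Type} [Field K] [NumberField K] (W : WeierstrassCurve ℚ) (τ : K ≃ₐ[ℚ] K) (n : ℤ)

/-- `H^{s} = H ∩ ker(conjAct − s)` (unfolding lit-ty's `signPart` ∕ `conjActH1`). -/
theorem signPart_eq_inf_ker (s : ℤ)
    (A : AddSubgroup (galoisCohomology ((W.baseChange K).torsionGaloisModule n) 1)) :
    signPart W K τ n s A = A ⊓ (conjAct W τ n - s • AddMonoidHom.id _).ker := rfl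

end SignPart

/-! ### The dual module `C'` and the package `hdual_q` -/

section Carrier

variable {K : Type} [Field K] [NumberField K] (W : WeierstrassCurve ℚ) [W.IsElliptic]
  (τ : K ≃ₐ[ℚ] K) (p k : ℕ) [Fact p.Prime] [NeZero (p ^ k)]
  [Finite (geomTorsion (W.baseChange K) ((p ^ k : ℕ) : ℤ))]
  (e : geomTorsion (W.baseChange K) ((p ^ k : ℕ) : ℤ) → geomTorsion (W.baseChange K) ((p ^ k : ℕ) : ℤ) →
    AlgebraicClosure K)
  (hμ : ∀ S T, e S T ^ (p ^ k) = 1)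
  (hadd₁ : ∀ S₁ S₂ T, e (S₁ + S₂) T = e S₁ T * e S₂ T)
  (hadd₂ : ∀ S T₁ T₂, e S (T₁ + T₂) = e S T₁ * e S T₂)
  (hgal : ∀ (g : absoluteGaloisGroup K) (S T : geomTorsion (W.baseChange K) ((p ^ k : ℕ) : ℤ)),
    g • e S T = e (g • S) (g • T))
  (halt : ∀ T, e T T = 1) (hnondeg : ∀ T, (∀ S, e S T = 1) → T = 0)
  (hτe : ∀ S T, liftAut τ (e S T) =
    e ((isLiftOfAut_liftAut τ).torsionMap W ((p ^ k : ℕ) : ℤ) S)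
      ((isLiftOfAut_liftAut τ).torsionMap W ((p ^ k : ℕ) : ℤ) T))

omit [Fact p.Prime] in
include hnondeg hτe in
/-- **`C' = w⁻¹(H¹_{𝓐^*} ∩ (H^D)^s)`**: the `s`-part of the pulled-back dual Selmer group is the
pull-back of the `s`-part (eigenclasses correspond under the Weil transport).
[cite: Jetchev2008, §5 Thm. 5.1] -/
theorem signPart_comap_map_weilDual (inv : LocalInvariants K (p ^ k))
    (𝓐 : SelmerStructure ((W.baseChange K).torsionGaloisModule ((p ^ k : ℕ) : ℤ))) (s : ℤ) :
    signPart W K τ ((p ^ k : ℕ) : ℤ) s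
        (((inv.dualSelmerStructure _ 𝓐).selmerGroup).comap (galoisCohomology.map
          (weilDualIntertwining (W.baseChange K) (p ^ k) e hμ hadd₁ hadd₂ hgal) 1)) =
      ((inv.dualSelmerStructure _ 𝓐).selmerGroup ⊓
          (conjActDual W τ ((p ^ k : ℕ) : ℤ) (p ^ k) - s • AddMonoidHom.id _).ker).comap
        (galoisCohomology.map (weilDualIntertwining (W.baseChange K) (p ^ k) e hμ hadd₁ hadd₂ hgal) 1) := by
  ext x
  rw [mem_signPart_iff, AddSubgroup.mem_comap, AddSubgroup.mem_comap, AddSubgroup.mem_inf,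
    AddMonoidHom.mem_ker, AddMonoidHom.sub_apply, AddMonoidHom.smul_apply, AddMonoidHom.id_apply,
    sub_eq_zero, conjActDual_map_weilDual_eq_smul_iff W (p ^ k) e hμ hadd₁ hadd₂ hgal hnondeg τ hτe]

-- one `set_option maxHeartbeats 400000` (2×): the assembly elaborates two restricted-codomain maps
-- with large dependent types (as in the end product `Rank1ResidualJetSignedGlobalDuality`)
set_option maxHeartbeats 400000 in
include halt hnondeg hτe in
/-- **The hypothesis `hdual_q` of `JET.tamagawaExponent_le_mInfty_of_rowData`, derived** (Jetchev
Thm. 5.1 at the carrier pair `{v₀, τ v₀}` for `𝓕₀ = 𝓕_⌈q⌉(c) ≼ 𝓕 = 𝓕(c)`, `s`-parts, with (δ):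
the local quotient `Kum_{v₀}/𝒮_{v₀}` cyclic of order `p^t`), for the dual module
`C' = signPart s (w⁻¹ H¹_{𝓕₀^*})`: `Qg = Kum_{v₀}/𝒮_{v₀}`, `Qg' = 𝒮_{v₀}^⊥/Kum_{v₀}^⊥`, `locq = loc_{v₀}`,
`locq' = loc'_{v₀} ∘ w`; `ker locq' = C' ∩ H_𝓕^s` by the self-duality of `𝓕(c)`;
`#im locq · #im locq' = [Kum_{v₀} : 𝒮_{v₀}] = #Qg'` by the signed counting and the local count.
[cite: Jetchev2008, Thm. 5.1, Lemma 5.2 (iii), proof of Thm. 5.2 (pp. 821–823)]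
[cite: Howard2004HeegnerKolyvagin, Thm. 2.1.11] [cite: MilneADT2006, Ch. I, Cor. 2.3] -/
theorem exists_locq_of_pair (hτ : τ * τ = 1) (hp2 : p ≠ 2) (hk : 1 ≤ k)
    (inv : LocalInvariants K (p ^ k)) (hperf : inv.IsPerfect) (hvan : inv.SumLocalTermEqZero)
    (hSC : inv.SelmerComplement) (hinv : inv.IsConjCompatible τ)
    (𝒯 𝒮 : SelmerStructure ((W.baseChange K).torsionGaloisModule ((p ^ k : ℕ) : ℤ)))
    {c : ℕ} (hc : c ≠ 0)
    (h𝒯σ : ∀ (v w : HeightOneSpectrum (𝓞 K)) (h : τ • v = w), v ∈ placesDividing K c →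
      ∀ x : galoisCohomology (((W.baseChange K).torsionGaloisModule ((p ^ k : ℕ) : ℤ)).toLocal
        (Sum.inr v : Place K)) 1,
      x ∈ 𝒯 (Sum.inr v) → conjActPlace W τ ((p ^ k : ℕ) : ℤ) h x ∈ 𝒯 (Sum.inr w))
    (h𝒯sd : ∀ v ∈ placesDividing K c,
      inv.dualTransported 𝒯 (weilDualIntertwining (W.baseChange K) (p ^ k) e hμ hadd₁ hadd₂ hgal)
        (Sum.inr v) = 𝒯 (Sum.inr v))
    (hS : ∀ v, 𝒮 v ≤ (W.baseChange K).kummerSelmerStructure ((p ^ k : ℕ) : ℤ) v)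
    (v₀ : HeightOneSpectrum (𝓞 K)) (hv₀ : τ • v₀ ≠ v₀)
    (hQc : Disjoint ({v₀, τ • v₀} : Finset (HeightOneSpectrum (𝓞 K))) (placesDividing K c))
    (h𝒮σ : ∀ (v w : HeightOneSpectrum (𝓞 K)) (h : τ • v = w), v ∈ ({v₀, τ • v₀} : Finset _) →
      ∀ x : galoisCohomology (((W.baseChange K).torsionGaloisModule ((p ^ k : ℕ) : ℤ)).toLocal
        (Sum.inr v : Place K)) 1,
      x ∈ 𝒮 (Sum.inr v) → conjActPlace W τ ((p ^ k : ℕ) : ℤ) h x ∈ 𝒮 (Sum.inr w))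
    {t : ℕ}
    (hcyc : IsAddCyclic (↥((W.baseChange K).kummerSelmerStructure ((p ^ k : ℕ) : ℤ) (Sum.inr v₀)) ⧸
      (𝒮 (Sum.inr v₀)).addSubgroupOf ((W.baseChange K).kummerSelmerStructure ((p ^ k : ℕ) : ℤ) (Sum.inr v₀))))
    (hidx : (𝒮 (Sum.inr v₀)).relIndex
      ((W.baseChange K).kummerSelmerStructure ((p ^ k : ℕ) : ℤ) (Sum.inr v₀)) = p ^ t)
    {s : ℤ} (hs : s = 1 ∨ s = -1) :
    ∃ (Qg Qg' : Type) (_ : AddCommGroup Qg) (_ : AddCommGroup Qg') (_ : Finite Qg')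
      (locq : signPart W K τ ((p ^ k : ℕ) : ℤ) s
        (selmerF W ((p ^ k : ℕ) : ℤ) 𝒯 (placesDividing K c)).selmerGroup →+ Qg)
      (locq' : signPart W K τ ((p ^ k : ℕ) : ℤ) s
        (((inv.dualSelmerStructure _ (selmerF0 W ((p ^ k : ℕ) : ℤ) 𝒯 𝒮 (placesDividing K c)
          {v₀, τ • v₀})).selmerGroup).comap (galoisCohomology.map
          (weilDualIntertwining (W.baseChange K) (p ^ k) e hμ hadd₁ hadd₂ hgal) 1)) →+ Qg'),
      (∀ x, locq' x = 0 ↔ (x : galoisCohomology ((W.baseChange K).torsionGaloisModule ((p ^ k : ℕ) : ℤ)) 1) ∈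
        signPart W K τ ((p ^ k : ℕ) : ℤ) s
          (selmerF W ((p ^ k : ℕ) : ℤ) 𝒯 (placesDividing K c)).selmerGroup) ∧
      Nat.card locq.range * Nat.card locq'.range = Nat.card Qg' ∧ IsAddCyclic Qg' ∧
      Nat.card Qg' = p ^ t := by
  -- basic facts
  have hp : p.Prime := Fact.out
  have hodd : Odd (p ^ k) := (hp.odd_of_ne_two hp2).pow
  have hppow : IsPrimePow (p ^ k) := ⟨p, k, hp.prime, hk, rfl⟩
  have hM : ∀ P : geomTorsion (W.baseChange K) ((p ^ k : ℕ) : ℤ), (p ^ k) • P = 0 := fun P => by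
    simpa using (W.baseChange K).natAbs_nsmul_geomTorsion P
  have hσσ : ∀ v : HeightOneSpectrum (𝓞 K), τ • τ • v = v := fun v => by
    rw [← mul_smul, hτ, one_smul]
  set Q : Finset (HeightOneSpectrum (𝓞 K)) := {v₀, τ • v₀} with hQ
  have hQτ : ∀ v : HeightOneSpectrum (𝓞 K), τ • v ∈ Q ↔ v ∈ Q := fun v => by
    simp only [hQ, Finset.mem_insert, Finset.mem_singleton]
    constructor
    · rintro (h | h)
      · right; rw [← h, hσσ]
      · left; simpa [hσσ] using congrArg (τ • ·) h
    · rintro (rfl | rfl)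
      · right; rfl
      · left; exact hσσ v₀
  -- the structures `𝓕 = 𝓕(c)`, `𝓕₀ = 𝓕_⌈q⌉(c)` and their properties
  set F := selmerF W ((p ^ k : ℕ) : ℤ) 𝒯 (placesDividing K c) with hF
  set F0 := selmerF0 W ((p ^ k : ℕ) : ℤ) 𝒯 𝒮 (placesDividing K c) Q with hF0
  set Kum := (W.baseChange K).kummerSelmerStructure ((p ^ k : ℕ) : ℤ) with hKum
  set wH := galoisCohomology.map (weilDualIntertwining (W.baseChange K) (p ^ k) e hμ hadd₁ hadd₂ hgal) 1
    with hwH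
  have hle : F0 ≤ F := selmerF0_le_selmerF W _ 𝒯 𝒮 Q hS hQc
  have hFσ := conjActPlace_mem_selmerF W τ ((p ^ k : ℕ) : ℤ) 𝒯 hc h𝒯σ
  have hF0σ := conjActPlace_mem_selmerF0 W τ ((p ^ k : ℕ) : ℤ) 𝒯 𝒮 Q hc h𝒯σ hQτ h𝒮σ
  have hFinf : ∀ w : InfinitePlace K, F (Sum.inl w) = ⊤ := fun w =>
    addSubgroup_inl_eq_top_of_odd W (p ^ k) hodd w _
  have hF0inf : ∀ w : InfinitePlace K, F0 (Sum.inl w) = ⊤ := fun w =>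
    addSubgroup_inl_eq_top_of_odd W (p ^ k) hodd w _
  have hF0dinf : ∀ w : InfinitePlace K,
      inv.dualSelmerStructure ((W.baseChange K).torsionGaloisModule ((p ^ k : ℕ) : ℤ)) F0 (Sum.inl w) = ⊤ :=
    fun w => addSubgroup_tateDual_inl_eq_top_of_odd W (p ^ k) hodd w _
  have hinj : ∀ v : HeightOneSpectrum (𝓞 K), Injective (inv (Sum.inr v)) := fun v => (hperf v).1.injective
  have hsd : ∀ v, inv.dualTransported F (weilDualIntertwining (W.baseChange K) (p ^ k) e hμ hadd₁ hadd₂ hgal) v =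
      F v :=
    dualTransported_selmerF_eq W (p ^ k) e hμ hadd₁ hadd₂ hgal halt hnondeg hppow hodd inv hinj 𝒯 c h𝒯sd
  have hoffP : ∀ v : Place K, v ≠ Sum.inr v₀ → v ≠ Sum.inr (τ • v₀) → F0 v = F v := fun v h1 h2 =>
    selmerF0_eq_selmerF_of_not_mem W _ 𝒯 𝒮 Q v (fun q hq => by
      simp only [hQ, Finset.mem_insert, Finset.mem_singleton] at hq
      rcases hq with rfl | rfl
      exacts [h1, h2])
  -- an exceptional set
  obtain ⟨S, T, hPT, hST, hTσ, -, hSram, h𝓚⟩ :=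
    exists_symmetric_exceptional W τ p k hτ (placesDividing K c ∪ Q)
  have hcS : ∀ v ∈ placesDividing K c, (Sum.inr v : Place K) ∈ S := fun v hv =>
    (hST v).mpr (hPT (Finset.mem_union_left _ hv))
  have hQS : ∀ v ∈ Q, (Sum.inr v : Place K) ∈ S := fun v hv =>
    (hST v).mpr (hPT (Finset.mem_union_right _ hv))
  have hFunr := selmerF_isUnramifiedOutside W ((p ^ k : ℕ) : ℤ) 𝒯 (c := c) h𝓚 hcS
  have hF0unr := selmerF0_isUnramifiedOutside W ((p ^ k : ℕ) : ℤ) 𝒯 𝒮 Q (c := c) h𝓚 hcS hQS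
  have hv₀Q : v₀ ∈ Q := by simp [hQ]
  have hv₀T : v₀ ∈ T := hPT (Finset.mem_union_right _ hv₀Q)
  have hoff : ∀ v ∈ T, v ≠ v₀ → v ≠ τ • v₀ → F0 (Sum.inr v) = F (Sum.inr v) := fun v _ h1 h2 =>
    hoffP (Sum.inr v) (fun h => h1 (Sum.inr_injective h)) (fun h => h2 (Sum.inr_injective h))
  -- the signed counting at the pair
  have key := relIndex_mul_relIndex_eq_of_pair W τ ((p ^ k : ℕ) : ℤ) hτ hodd hM inv hperf hvan hSC hinv
    S T hST hTσ hSram hle hF0unr hFunr hF0σ hFσ hF0inf hFinf hF0dinf hv₀T hv₀ hoff hs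
  -- the local conditions at `v₀`
  have hv₀c : v₀ ∉ placesDividing K c := Finset.disjoint_left.mp hQc hv₀Q
  have hF0v₀ : F0 (Sum.inr v₀) = 𝒮 (Sum.inr v₀) := by rw [hF0, selmerF0_inr, if_pos hv₀Q]
  have hFv₀ : F (Sum.inr v₀) = Kum (Sum.inr v₀) := by rw [hF, selmerF_inr, if_neg hv₀c]
  rw [hF0v₀, hFv₀] at key
  -- finiteness of the local cohomology at `v₀`
  haveI := finite_galoisCohomology_one_toLocal ((W.baseChange K).torsionGaloisModule ((p ^ k : ℕ) : ℤ)) v₀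
  haveI := finite_galoisCohomology_one_tateDual_toLocal
    ((W.baseChange K).torsionGaloisModule ((p ^ k : ℕ) : ℤ)) (p ^ k) v₀
  -- X side: `locq = loc_{v₀} : H_𝓕^s → Kum_{v₀}/𝒮_{v₀}`
  have hlocA : ∀ x : signPart W K τ ((p ^ k : ℕ) : ℤ) s F.selmerGroup,
      galoisCohomology.localization ((W.baseChange K).torsionGaloisModule ((p ^ k : ℕ) : ℤ))
        (Sum.inr v₀ : Place K) 1 (x : galoisCohomology _ 1) ∈ Kum (Sum.inr v₀) := fun x => by
    have hx := ((mem_signPart_iff W K τ _ s _ _).mp x.2).1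
    have := (SelmerStructure.mem_selmerGroup_iff _ _).mp hx (Sum.inr v₀)
    rwa [hFv₀] at this
  let locq : signPart W K τ ((p ^ k : ℕ) : ℤ) s F.selmerGroup →+
      (↥(Kum (Sum.inr v₀)) ⧸ (𝒮 (Sum.inr v₀)).addSubgroupOf (Kum (Sum.inr v₀))) :=
    (QuotientAddGroup.mk' _).comp
      (((galoisCohomology.localization ((W.baseChange K).torsionGaloisModule ((p ^ k : ℕ) : ℤ))
        (Sum.inr v₀ : Place K) 1).comp (AddSubgroup.subtype _)).codRestrict _ hlocA)
  have hlocq : ∀ x, locq x = 0 ↔ (x : galoisCohomology _ 1) ∈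
      signPart W K τ ((p ^ k : ℕ) : ℤ) s F0.selmerGroup := by
    intro x
    obtain ⟨hxF, hxs⟩ := (mem_signPart_iff W K τ _ s _ _).mp x.2
    simp only [locq, AddMonoidHom.comp_apply, QuotientAddGroup.mk'_apply, QuotientAddGroup.eq_zero_iff,
      AddSubgroup.mem_addSubgroupOf, AddMonoidHom.codRestrict_apply, AddSubgroup.coe_subtype]
    rw [← hF0v₀, ← mem_selmerGroup_iff_localization_mem_of_pair W τ _ hs (𝓕 := F0) (𝓖 := F) v₀ hoffP
      (fun y hy => hF0σ v₀ (τ • v₀) rfl y hy) hxF hxs, mem_signPart_iff]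
    exact ⟨fun h => ⟨h, hxs⟩, fun h => h.1⟩
  have hcardq : Nat.card locq.range = (signPart W K τ ((p ^ k : ℕ) : ℤ) s F0.selmerGroup).relIndex
      (signPart W K τ ((p ^ k : ℕ) : ℤ) s F.selmerGroup) := natCard_range_eq_relIndex locq hlocq
  -- dual side: `locq' = loc'_{v₀} ∘ w : C' → 𝒮_{v₀}^⊥/Kum_{v₀}^⊥`
  have hlocC : ∀ x : signPart W K τ ((p ^ k : ℕ) : ℤ) s
      (((inv.dualSelmerStructure _ F0).selmerGroup).comap wH),
      galoisCohomology.localization (((W.baseChange K).torsionGaloisModule ((p ^ k : ℕ) : ℤ)).tateDual (p ^ k))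
        (Sum.inr v₀ : Place K) 1 (wH (x : galoisCohomology _ 1)) ∈
        inv.dualLocalCondition _ (Sum.inr v₀ : Place K) (𝒮 (Sum.inr v₀)) := fun x => by
    have hx := ((mem_signPart_iff W K τ _ s _ _).mp x.2).1
    have := (SelmerStructure.mem_selmerGroup_iff _ _).mp (AddSubgroup.mem_comap.mp hx) (Sum.inr v₀)
    rwa [LocalInvariants.dualSelmerStructure_apply, hF0v₀] at this
  let locq' : signPart W K τ ((p ^ k : ℕ) : ℤ) s (((inv.dualSelmerStructure _ F0).selmerGroup).comap wH) →+
      (↥(inv.dualLocalCondition _ (Sum.inr v₀ : Place K) (𝒮 (Sum.inr v₀))) ⧸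
        (inv.dualLocalCondition _ (Sum.inr v₀ : Place K) (Kum (Sum.inr v₀))).addSubgroupOf
          (inv.dualLocalCondition _ (Sum.inr v₀ : Place K) (𝒮 (Sum.inr v₀)))) :=
    (QuotientAddGroup.mk' _).comp
      (((galoisCohomology.localization (((W.baseChange K).torsionGaloisModule ((p ^ k : ℕ) : ℤ)).tateDual
        (p ^ k)) (Sum.inr v₀ : Place K) 1).comp (wH.comp (AddSubgroup.subtype _))).codRestrict _ hlocC)
  have hlocq' : ∀ x, locq' x = 0 ↔ (x : galoisCohomology _ 1) ∈
      signPart W K τ ((p ^ k : ℕ) : ℤ) s F.selmerGroup := by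
    intro x
    obtain ⟨hxw, hxs⟩ := (mem_signPart_iff W K τ _ s _ _).mp x.2
    have hys := (conjActDual_map_weilDual_eq_smul_iff W (p ^ k) e hμ hadd₁ hadd₂ hgal hnondeg τ hτe s
      (x : galoisCohomology _ 1)).mpr hxs
    simp only [locq', AddMonoidHom.comp_apply, QuotientAddGroup.mk'_apply, QuotientAddGroup.eq_zero_iff,
      AddSubgroup.mem_addSubgroupOf, AddMonoidHom.codRestrict_apply, AddSubgroup.coe_subtype]
    rw [← hFv₀, ← mem_dualSelmerGroup_iff_localization_mem_of_pair W τ _ hτ hs inv hinv (𝓕 := F0) (𝓖 := F)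
      v₀ hoffP hFσ (AddSubgroup.mem_comap.mp hxw) hys, ← AddSubgroup.mem_comap,
      comap_map_weilDual_selmerGroup_of_selfDual W (p ^ k) e hμ hadd₁ hadd₂ hgal inv F hsd, mem_signPart_iff]
    exact ⟨fun h => ⟨h, hxs⟩, fun h => h.1⟩
  have hcardq' : Nat.card locq'.range = (signPart W K τ ((p ^ k : ℕ) : ℤ) s F.selmerGroup).relIndex
      (signPart W K τ ((p ^ k : ℕ) : ℤ) s (((inv.dualSelmerStructure _ F0).selmerGroup).comap wH)) :=
    natCard_range_eq_relIndex locq' hlocq'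
  -- the two indices are the two factors of the signed counting
  have hA : signPart W K τ ((p ^ k : ℕ) : ℤ) s F.selmerGroup =
      ((inv.dualSelmerStructure _ F).selmerGroup ⊓
        (conjActDual W τ ((p ^ k : ℕ) : ℤ) (p ^ k) - s • AddMonoidHom.id _).ker).comap wH := by
    rw [← comap_map_weilDual_selmerGroup_of_selfDual W (p ^ k) e hμ hadd₁ hadd₂ hgal inv F hsd]
    exact signPart_comap_map_weilDual W τ p k e hμ hadd₁ hadd₂ hgal hnondeg hτe inv F s
  have hC : signPart W K τ ((p ^ k : ℕ) : ℤ) s (((inv.dualSelmerStructure _ F0).selmerGroup).comap wH) =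
      ((inv.dualSelmerStructure _ F0).selmerGroup ⊓
        (conjActDual W τ ((p ^ k : ℕ) : ℤ) (p ^ k) - s • AddMonoidHom.id _).ker).comap wH :=
    signPart_comap_map_weilDual W τ p k e hμ hadd₁ hadd₂ hgal hnondeg hτe inv F0 s
  have hfactor2 : Nat.card locq'.range =
      ((inv.dualSelmerStructure _ F).selmerGroup ⊓
        (conjActDual W τ ((p ^ k : ℕ) : ℤ) (p ^ k) - s • AddMonoidHom.id _).ker).relIndex
      ((inv.dualSelmerStructure _ F0).selmerGroup ⊓
        (conjActDual W τ ((p ^ k : ℕ) : ℤ) (p ^ k) - s • AddMonoidHom.id _).ker) := by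
    rw [hcardq', hA, hC]
    exact relIndex_comap_map_weilDual W (p ^ k) e hμ hadd₁ hadd₂ hgal hnondeg _ _
  have hfactor1 : Nat.card locq.range =
      (F0.selmerGroup ⊓ (conjAct W τ ((p ^ k : ℕ) : ℤ) - s • AddMonoidHom.id _).ker).relIndex
        (F.selmerGroup ⊓ (conjAct W τ ((p ^ k : ℕ) : ℤ) - s • AddMonoidHom.id _).ker) := by
    rw [hcardq]; rfl
  -- the local count and the cyclicity at `v₀`
  have hcardQ : Nat.card (↥(inv.dualLocalCondition _ (Sum.inr v₀ : Place K) (𝒮 (Sum.inr v₀))) ⧸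
      (inv.dualLocalCondition _ (Sum.inr v₀ : Place K) (Kum (Sum.inr v₀))).addSubgroupOf
        (inv.dualLocalCondition _ (Sum.inr v₀ : Place K) (𝒮 (Sum.inr v₀)))) =
      (𝒮 (Sum.inr v₀)).relIndex (Kum (Sum.inr v₀)) := by
    rw [natCard_quotient_addSubgroupOf]
    exact relIndex_dualLocalCondition_eq inv hperf _ hM v₀ _ _ (hS _)
  refine ⟨_, _, inferInstance, inferInstance, inferInstance, locq, locq', hlocq', ?_,
    isAddCyclic_dualLocalCondition_quotient inv _ _ _ _ hcyc, hcardQ.trans hidx⟩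
  rw [hcardQ, ← key, hfactor1, hfactor2]


end Carrier

end Summit.BirchSwinnertonDyer.Rank1Residual.JET.GlobalDuality

end
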